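import Summits.Langlands.Langlands.Statement
import Literature.NumberTheory.EllipticCurves.FramedTateGaloisRep
import Literature.NumberTheory.Automorphic.TotallyRealModularity
import Literature.NumberTheory.Automorphic.ReciprocityGLnPotentialModularityTateProofs
import HarnessLib

/-!
# `QuinticEllipticGaloisToAutomorphic_special` — F3 instantiation witnesses (forward generator G4, generation 6)

The rung family `EllipticGaloisToAutomorphicTR d` (dial = degree `d` of the totally real base field;
clause (B) of the summit at `n = 2` on the elliptic sector, Galois-side, archimedean-free) SPECIALISES
LITERALLY to the tree's floors:

* `floor_two   : FLS2015_theorem1 → EllipticGaloisToAutomorphicTR 2` (Freitas–Le Hung–Siksek 2015, Thm. 1),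
* `floor_three : DNS2020_theorem4 → EllipticGaloisToAutomorphicTR 3` (Derickx–Najman–Siksek 2020, Thm. 4),
* `rung_four_of_not_isSquare_five : Box2022_theorem1_1 → …` (Box 2022, Thm. 1.1: the `√5 ∉ K` cell of `d = 4`),

all through ONE bridge `of_isAutomorphicOfWeightZero`: weight-zero automorphy of the integral model
`E / 𝓞 K` (`IsAutomorphicOfWeightZero`: Hecke polynomial `X² - a_w X + q_w` at every `w ∤ Δ(E)`) gives the
family's conclusion with shift `m = 2` for the framed dual Tate module `ρ_{E,ℓ}^∨`, by the tree theorems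
`hasFrobCharpolyAt_rationalTateGaloisRepOf_of_hasGoodReductionAt` (Silverman C.21 Rem. 21.3, with the
discharged trace/determinant facts), `hasFrobCharpolyAt_framedTateGaloisRepDual`,
`frobeniusTraceAt_baseChange_eq_frobTraceAt`, `exists_hasSatakeParamAt_of_hasHeckePolynomialAt_frobPoly`
and the identity `∏_j (X - ι⁻¹((q^{1/2} α_j)⁻¹)) = X² - (a/q) X + q⁻¹` when
`∏_j (X - q^{1/2} α_j) = X² - a X + q` (`arithFrobPolyOfSatake_two_pair`).  No `sorry`; the floors are
the tree's NAMED FACTS taken as hypotheses (floor debt recorded in the skeleton's `stub_floorFacts`).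
-/

noncomputable section

set_option linter.dupNamespace false

open scoped MatrixGroups Matrix NumberField Classical Polynomial
open Filter IsDedekindDomain Field Polynomial WeierstrassCurve
open Literature.NumberTheory.Automorphic Literature.NumberTheory.GaloisRepresentations
open Literature.NumberTheory.EllipticCurves
open Literature.NumberTheory.PAdicHodge
open Summit.Langlands

namespace Summit.Langlands.Langlands.Cruxes.ReciprocityUpToIrreducibility.QuinticEllipticGaloisToAutomorphic

/-- The rung family (verbatim as in `QuinticEllipticGaloisToAutomorphic_onpath` / the skeleton). -/
def EllipticGaloisToAutomorphicTR (d : ℕ) : Prop :=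
  ∀ (K : Type) [Field K] [NumberField K] [NumberField.IsTotallyReal K], Module.finrank ℚ K = d →
    ∀ (E : WeierstrassCurve (𝓞 K)) [(E.baseChange K).IsElliptic] (ℓ : ℕ) [Fact ℓ.Prime]
      (ι : PadicAlgCl ℓ ≃+* ℂ),
      ((E.baseChange K).framedTateGaloisRepDual ℓ).toGaloisRep.IsIrreducible →
      (∀ (v : HeightOneSpectrum (𝓞 K)) (hv : ((ℓ : ℕ) : 𝓞 K) ∈ v.asIdeal),
          (fontainePstAdicCompletion v ℓ hv).IsDeRhamFramed
            (((E.baseChange K).framedTateGaloisRepDual ℓ).toLocal v)) →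
      ∃ (hK : isCompact_glFiniteIntegralLevel 2 K) (π : CuspidalAutomorphicRepData 2 K hK) (m : ℕ),
        ∀ᶠ v : HeightOneSpectrum (𝓞 K) in Filter.cofinite, ∃ α : Multiset ℂ,
          π.1.HasSatakeParamAt v α ∧
          ((E.baseChange K).framedTateGaloisRepDual ℓ).IsUnramifiedAt v ∧
          ((E.baseChange K).framedTateGaloisRepDual ℓ).HasFrobCharpolyAt v
            (arithFrobPolyOfSatake ι v.residueCard m α)

/-- The rung (verbatim): `d = 5`. -/
def QuinticEllipticGaloisToAutomorphic : Prop := EllipticGaloisToAutomorphicTR 5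

/-! ### The bridge: weight-zero automorphy of the model gives the family's conclusion with `m = 2` -/

/-- An integral model whose generic fibre is an elliptic curve has `Δ ≠ 0`
(`(E ⊗ K).Δ = algebraMap Δ(E)` is a unit). [folklore] -/
theorem Δ_ne_zero_of_isElliptic_baseChange {K : Type} [Field K] [NumberField K]
    (E : WeierstrassCurve (𝓞 K)) [(E.baseChange K).IsElliptic] : E.Δ ≠ 0 := by
  intro h0
  have hu := (E.baseChange K).isUnit_Δ
  rw [WeierstrassCurve.baseChange, WeierstrassCurve.map_Δ, h0, map_zero] at hu
  exact not_isUnit_zero hu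

/-- **Normalisation identity.** If `q^{1/2}(z₁ + z₂) = a` and `q (z₁ z₂) = q ≠ 0` (the unitary Satake
parameter `{z₁, z₂}` of a weight-zero `π_w` with Hecke polynomial `X² - a X + q`), then Buzzard–Gee's
shifted arithmetic-Frobenius polynomial with `m = 2` is `X² - (a/q) X + q⁻¹` — the characteristic
polynomial of the arithmetic Frobenius on the DUAL of a representation on which it is `X² - a X + q`.
[folklore] -/
theorem arithFrobPolyOfSatake_two_pair {ℓ : ℕ} [Fact ℓ.Prime] (ι : PadicAlgCl ℓ ≃+* ℂ) (q : ℕ)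
    (a : ℤ) (z₁ z₂ : ℂ) (hq : q ≠ 0)
    (hsum : ((Real.sqrt q : ℝ) : ℂ) * ({z₁, z₂} : Multiset ℂ).sum = (a : ℂ))
    (hprod : ((Real.sqrt q : ℝ) : ℂ) ^ 2 * ({z₁, z₂} : Multiset ℂ).prod = (q : ℂ)) :
    arithFrobPolyOfSatake ι q 2 {z₁, z₂} =
      X ^ 2 - C ((a : PadicAlgCl ℓ) / (q : PadicAlgCl ℓ)) * X + C ((q : PadicAlgCl ℓ)⁻¹) := by
  have hs : ((Real.sqrt q : ℝ) : ℂ) * z₁ + ((Real.sqrt q : ℝ) : ℂ) * z₂ = a := by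
    simpa [Multiset.insert_eq_cons, mul_add] using hsum
  have hp' : ((Real.sqrt q : ℝ) : ℂ) ^ 2 * (z₁ * z₂) = q := by
    simpa [Multiset.insert_eq_cons] using hprod
  have hp : (((Real.sqrt q : ℝ) : ℂ) * z₁) * (((Real.sqrt q : ℝ) : ℂ) * z₂) = q := by
    linear_combination hp'
  have hq' : (q : ℂ) ≠ 0 := by exact_mod_cast hq
  have h1 : ((Real.sqrt q : ℝ) : ℂ) * z₁ ≠ 0 := fun h => hq' (by rw [← hp, h, zero_mul])
  have h2 : ((Real.sqrt q : ℝ) : ℂ) * z₂ ≠ 0 := fun h => hq' (by rw [← hp, h, mul_zero])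
  have hinv_sum : (((Real.sqrt q : ℝ) : ℂ) * z₁)⁻¹ + (((Real.sqrt q : ℝ) : ℂ) * z₂)⁻¹ = (a : ℂ) / q := by
    rw [inv_add_inv h1 h2, hs, hp]
  have hinv_prod : (((Real.sqrt q : ℝ) : ℂ) * z₁)⁻¹ * (((Real.sqrt q : ℝ) : ℂ) * z₂)⁻¹ = ((q : ℂ))⁻¹ := by
    rw [← mul_inv, hp]
  unfold arithFrobPolyOfSatake
  simp only [Multiset.insert_eq_cons, Multiset.map_cons, Multiset.map_singleton, Multiset.prod_cons,
    Multiset.prod_singleton, Nat.reduceSub, pow_one]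
  rw [X_sub_C_mul_X_sub_C, ← map_add ι.symm, ← map_mul ι.symm, hinv_sum, hinv_prod, map_div₀,
    map_inv₀, map_intCast, map_natCast]

/-- **THE BRIDGE.** Weight-zero automorphy of the integral model `E / 𝓞 K` (Hecke polynomial
`X² - a_w(E) X + q_w` at every `w ∤ Δ(E)`, `IsAutomorphicOfWeightZero`) implies the family's conclusion
for `ρ_{E,ℓ}^∨` with the same `π` and shift `m = 2`, at the cofinitely many `w ∤ ℓ Δ(E)`: there `E ⊗ K`
has good reduction (`hasGoodReductionAt_baseChange_of_Δ_not_mem`), `V_ℓ E` is unramified with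
arithmetic-Frobenius polynomial `X² - a_w X + q_w` (Silverman C.21 Rem. 21.3 as proved in the tree),
hence `ρ_{E,ℓ}^∨` has `X² - (a_w/q_w) X + q_w⁻¹` (`hasFrobCharpolyAt_framedTateGaloisRepDual`), which is
`arithFrobPolyOfSatake ι q_w 2 α` for the Satake parameter `α` read off the Hecke polynomial. [folklore] -/
theorem of_isAutomorphicOfWeightZero {K : Type} [Field K] [NumberField K]
    {E : WeierstrassCurve (𝓞 K)} [(E.baseChange K).IsElliptic]
    (hE : IsAutomorphicOfWeightZero E) (ℓ : ℕ) [Fact ℓ.Prime] (ι : PadicAlgCl ℓ ≃+* ℂ) :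
    ∃ (hK : isCompact_glFiniteIntegralLevel 2 K) (π : CuspidalAutomorphicRepData 2 K hK) (m : ℕ),
      ∀ᶠ v : HeightOneSpectrum (𝓞 K) in Filter.cofinite, ∃ α : Multiset ℂ,
        π.1.HasSatakeParamAt v α ∧
        ((E.baseChange K).framedTateGaloisRepDual ℓ).IsUnramifiedAt v ∧
        ((E.baseChange K).framedTateGaloisRepDual ℓ).HasFrobCharpolyAt v
          (arithFrobPolyOfSatake ι v.residueCard m α) := by
  have hΔ : E.Δ ≠ 0 := Δ_ne_zero_of_isElliptic_baseChange E
  obtain ⟨hK, π, -, hH⟩ := hE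
  refine ⟨hK, π, 2, ?_⟩
  have hc : Continuous fun x : Field.absoluteGaloisGroup K × (E.baseChange K).rationalTateModule ℓ =>
      Literature.NumberTheory.EllipticCurves.rationalTateRepresentation (Field.absoluteGaloisGroup K)
        (WeierstrassCurve.geomPoints (E.baseChange K)) ℓ x.1 x.2 :=
    (E.baseChange K).continuous_rationalGaloisRepTate_holds ℓ
  haveI hfin : Module.Finite ℚ_[ℓ] ((E.baseChange K).rationalTateModule ℓ) :=
    (E.baseChange K).module_finite_rationalTateModule_holds ℓ
  filter_upwards [eventually_not_mem_asIdeal hΔ,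
    eventually_natCast_not_mem_asIdeal K (Fact.out : ℓ.Prime).ne_zero] with v hvΔ hvℓ
  obtain ⟨α, hα, hsum, hprod⟩ := exists_hasSatakeParamAt_of_hasHeckePolynomialAt_frobPoly (hH v hvΔ)
  have hgood : (E.baseChange K).HasGoodReductionAt v := hasGoodReductionAt_baseChange_of_Δ_not_mem hvΔ
  have hF := hasFrobCharpolyAt_rationalTateGaloisRepOf_of_hasGoodReductionAt
    ((E.baseChange K).trace_galoisRepTate_frobenius_of_hasGoodReductionAt_holds ℓ)
    ((E.baseChange K).det_galoisRepTate_frobenius_of_hasGoodReductionAt_holds ℓ) hc hvℓ hgood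
  rw [frobeniusTraceAt_baseChange_eq_frobTraceAt hvΔ, natCard_residueField_eq_residueCard] at hF
  have hD := (E.baseChange K).hasFrobCharpolyAt_framedTateGaloisRepDual ℓ hc hF
  simp only [map_intCast, map_natCast] at hD
  refine ⟨α, hα, (E.baseChange K).isUnramifiedAt_framedTateGaloisRepDual ℓ hgood hvℓ, ?_⟩
  obtain ⟨z₁, z₂, rfl⟩ := Multiset.card_eq_two.1 hα.card_eq
  rw [arithFrobPolyOfSatake_two_pair ι v.residueCard (frobTraceAt E v) z₁ z₂
    (by have := v.one_lt_residueCard; omega)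
    hsum hprod]
  exact hD

/-! ### The floors: literal instances of the family -/

/-- **Floor `d = 2`** (Freitas–Le Hung–Siksek 2015, Thm. 1, the tree's named fact `FLS2015_theorem1`).
[cite: FreitasLeHungSiksek2015, Thm. 1] -/
theorem floor_two (h : FLS2015_theorem1) : EllipticGaloisToAutomorphicTR 2 := by
  intro K _ _ _ hd E _ ℓ _ ι _ _
  exact of_isAutomorphicOfWeightZero (h K hd E (Δ_ne_zero_of_isElliptic_baseChange E)) ℓ ι

/-- **Floor `d = 3` = THE F3 WITNESS** (Derickx–Najman–Siksek 2020, Thm. 4, the tree's named fact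
`DNS2020_theorem4`): the family at the floor value `θ₀ = 3` is the tree's floor verbatim up to the
bridge `of_isAutomorphicOfWeightZero`. [cite: DerickxNajmanSiksek2020, Thm. 4] -/
theorem floor_three (h : DNS2020_theorem4) : EllipticGaloisToAutomorphicTR 3 := by
  intro K _ _ _ hd E _ ℓ _ ι _ _
  exact of_isAutomorphicOfWeightZero (h K hd E (Δ_ne_zero_of_isElliptic_baseChange E)) ℓ ι

/-- **The decided cell of `d = 4`** (Box 2022, Thm. 1.1, named fact `Box2022_theorem1_1`): the family's
conclusion over totally real quartic fields with `√5 ∉ K`; the complementary cell is the open Target of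
route `Langlands/SqrtFiveQuarticCovers`. [cite: Box2022, Thm. 1.1] -/
theorem rung_four_of_not_isSquare_five (h : Box2022_theorem1_1) :
    ∀ (K : Type) [Field K] [NumberField K] [NumberField.IsTotallyReal K], Module.finrank ℚ K = 4 →
      ¬ IsSquare (5 : K) →
      ∀ (E : WeierstrassCurve (𝓞 K)) [(E.baseChange K).IsElliptic] (ℓ : ℕ) [Fact ℓ.Prime]
        (ι : PadicAlgCl ℓ ≃+* ℂ),
        ∃ (hK : isCompact_glFiniteIntegralLevel 2 K) (π : CuspidalAutomorphicRepData 2 K hK) (m : ℕ),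
          ∀ᶠ v : HeightOneSpectrum (𝓞 K) in Filter.cofinite, ∃ α : Multiset ℂ,
            π.1.HasSatakeParamAt v α ∧
            ((E.baseChange K).framedTateGaloisRepDual ℓ).IsUnramifiedAt v ∧
            ((E.baseChange K).framedTateGaloisRepDual ℓ).HasFrobCharpolyAt v
              (arithFrobPolyOfSatake ι v.residueCard m α) := by
  intro K _ _ _ hd h5 E _ ℓ _ ι
  exact of_isAutomorphicOfWeightZero (h K hd h5 E (Δ_ne_zero_of_isElliptic_baseChange E)) ℓ ι

/-- F3 in the brief's literal shape: `example : RungFamily θ₀` from the floor. -/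
example (h : DNS2020_theorem4) : EllipticGaloisToAutomorphicTR 3 := floor_three h

end Summit.Langlands.Langlands.Cruxes.ReciprocityUpToIrreducibility.QuinticEllipticGaloisToAutomorphic

end
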